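import Summits.NavierStokesRegularity.FunctionalMining.StrainSqTransport
import Summits.NavierStokesRegularity.FunctionalMining.CodomainNPTop
import HarnessLib

/-!
# FunctionalMining — the strain tensor as a Euclidean-valued test map (toward row `ES.absS.q=4`)

Search for candidate a priori estimates; no regularity claim. Cell `pub-nsfunc`, prove seat
(gen 9). To run the codomain-generic nonlinear Poincaré / Sobolev top node (`CodomainNPTop`) on
the strain moments `∫|S|^q` (rows `ES.absS.q|T_LD|G1` of the 𝒦₀ matrix) we package the strain
entries `Sᵢⱼ = ((∂ⱼv)ᵢ + (∂ᵢv)ⱼ)/2` of a velocity field `v` on `T^d` as ONE map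
`strainFlat v : T^d → EuclideanSpace ℝ (d × d)`, so that `‖strainFlat v x‖² = |S(x)|²`
(`torusStrainSqAt`), `strainFlat v` is smooth and zero-mean, and
`∑ₖ‖∂ₖ strainFlat v‖² = ∑ₖ∑ᵢⱼ(∂ₖSᵢⱼ)²` is the density of the weighted dissipation of the strain
balance (`StrainViscous`). The generic top node at `a = 1` then gives, on `T³`,
`∫|S|¹² ≤ C (∫|S|²∑ₖ∑ᵢⱼ(∂ₖSᵢⱼ)²)³`.

## Main statements

* `EuclideanCoord.isSmooth_of_coord`, `partialDeriv_apply_coord`, `integral_apply_coord` —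
  coordinate calculus for `EuclideanSpace ℝ ι`-valued maps on `T^d` (any index type `ι`).
* `strainFlat`, `norm_strainFlat_sq`, `isSmooth_strainFlat`, `hasZeroMean_strainFlat`,
  `sum_norm_partialDeriv_strainFlat_sq`.
* `exists_strainSq_pow_six_le_cube` — the top node `∫|S|¹² ≤ C (∫|S|²|∇S|²)³` on `T³`.
-/

noncomputable section

open MeasureTheory Finset Set
open scoped InnerProductSpace RealInnerProductSpace ContDiff

namespace Summit.NavierStokesRegularity.FunctionalMining

open Literature.Analysis.FunctionSpaces Literature.Analysis.FunctionSpaces.Torus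
  Literature.Analysis.FluidPDE

/-! ## 1. Coordinate calculus for `EuclideanSpace ℝ ι`-valued maps -/

namespace EuclideanCoord

variable {d : Type*} [Fintype d] [DecidableEq d] {ι : Type*} [Fintype ι]

omit [DecidableEq d] in
/-- A map into `EuclideanSpace ℝ ι` with smooth coordinates is smooth. [folklore] -/
theorem isSmooth_of_coord {w : UnitAddTorus d → EuclideanSpace ℝ ι}
    (h : ∀ p, IsSmooth (fun x => w x p)) : IsSmooth w := by
  unfold IsSmooth
  exact contDiff_euclidean.2 fun p => h p

omit [DecidableEq d] in
/-- Coordinates commute with the torus derivative. [folklore] -/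
theorem fderiv_apply_coord {w : UnitAddTorus d → EuclideanSpace ℝ ι} (hw : IsContDiff 1 w)
    (x : UnitAddTorus d) (v : EuclideanSpace ℝ d) (p : ι) :
    Torus.fderiv (fun y => w y p) x v = Torus.fderiv w x v p := by
  have hd : DifferentiableAt ℝ (liftAt w x) 0 :=
    ((hw.liftAt x).differentiable one_ne_zero).differentiableAt
  have h : liftAt (fun y => w y p) x =
      (EuclideanSpace.proj p : EuclideanSpace ℝ ι →L[ℝ] ℝ) ∘ liftAt w x := rfl
  rw [Torus.fderiv, Torus.fderiv, h,
    ((EuclideanSpace.proj p).hasFDerivAt.comp (0 : EuclideanSpace ℝ d) hd.hasFDerivAt).fderiv]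
  rfl

/-- Coordinates commute with partial derivatives: `∂ᵢ(w_p) = (∂ᵢw)_p` for `C¹` maps. [folklore] -/
theorem partialDeriv_apply_coord {w : UnitAddTorus d → EuclideanSpace ℝ ι} (hw : IsContDiff 1 w)
    (i : d) (x : UnitAddTorus d) (p : ι) :
    partialDeriv i (fun y => w y p) x = partialDeriv i w x p := by
  have hw' : IsContDiff 1 (fun y => w y p) :=
    (EuclideanSpace.proj p : EuclideanSpace ℝ ι →L[ℝ] ℝ).contDiff.comp hw
  rw [partialDeriv_eq_fderiv_apply hw', partialDeriv_eq_fderiv_apply hw, fderiv_apply_coord hw]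

omit [DecidableEq d] in
/-- Coordinates commute with the Bochner integral over `T^d` (continuous integrand). [folklore] -/
theorem integral_apply_coord {w : UnitAddTorus d → EuclideanSpace ℝ ι} (hw : Continuous w) (p : ι) :
    (∫ x, w x) p = ∫ x, w x p := by
  have h := (EuclideanSpace.proj p : EuclideanSpace ℝ ι →L[ℝ] ℝ).integral_comp_comm
    hw.integrable_unitAddTorus
  exact h.symm

omit [Fintype d] [DecidableEq d] in
/-- `‖w‖² = ∑_p w_p²` in `EuclideanSpace ℝ ι`. [folklore] -/
theorem norm_sq_eq_sum_sq (w : EuclideanSpace ℝ ι) : ‖w‖ ^ 2 = ∑ p, w p ^ 2 := by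
  rw [EuclideanSpace.norm_sq_eq]
  exact Finset.sum_congr rfl fun p _ => by rw [Real.norm_eq_abs, sq_abs]

end EuclideanCoord

/-! ## 2. The flattened strain -/

namespace StrainL4

variable {d : Type*} [Fintype d] [DecidableEq d]

/-- The strain tensor of `v` as a map into `EuclideanSpace ℝ (d × d)`:
`strainFlat v x (i, j) = Sᵢⱼ(x) = ((∂ⱼv)ᵢ(x) + (∂ᵢv)ⱼ(x))/2`. Search for candidate a priori estimates;
no regularity claim. [ours; packaging] -/
def strainFlat (v : UnitAddTorus d → EuclideanSpace ℝ d) (x : UnitAddTorus d) :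
    EuclideanSpace ℝ (d × d) :=
  WithLp.toLp 2 fun p => (Torus.partialDeriv p.2 v x p.1 + Torus.partialDeriv p.1 v x p.2) / 2

/-- Entries of the flattened strain. [ours] -/
@[simp] theorem strainFlat_apply (v : UnitAddTorus d → EuclideanSpace ℝ d) (x : UnitAddTorus d)
    (p : d × d) :
    strainFlat v x p = (Torus.partialDeriv p.2 v x p.1 + Torus.partialDeriv p.1 v x p.2) / 2 := rfl

/-- `‖strainFlat v x‖² = |S(x)|²`. [ours] -/
theorem norm_strainFlat_sq (v : UnitAddTorus d → EuclideanSpace ℝ d) (x : UnitAddTorus d) :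
    ‖strainFlat v x‖ ^ 2 = torusStrainSqAt v x := by
  rw [EuclideanCoord.norm_sq_eq_sum_sq, torusStrainSqAt, Fintype.sum_prod_type]
  rfl

/-- `‖strainFlat v x‖ = √|S(x)|²`. [ours] -/
theorem norm_strainFlat_eq_sqrt (v : UnitAddTorus d → EuclideanSpace ℝ d) (x : UnitAddTorus d) :
    ‖strainFlat v x‖ = Real.sqrt (torusStrainSqAt v x) := by
  rw [← norm_strainFlat_sq, Real.sqrt_sq (norm_nonneg _)]

/-- The flattened strain of a smooth field is smooth. [ours] -/
theorem isSmooth_strainFlat {v : UnitAddTorus d → EuclideanSpace ℝ d} (hv : Torus.IsSmooth v) :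
    Torus.IsSmooth (strainFlat v) :=
  EuclideanCoord.isSmooth_of_coord fun p => by
    simpa only [strainFlat_apply] using GradientTensor.isSmooth_strainEntry hv p.1 p.2

/-- The flattened strain is continuous. [ours] -/
theorem continuous_strainFlat {v : UnitAddTorus d → EuclideanSpace ℝ d} (hv : Torus.IsSmooth v) :
    Continuous (strainFlat v) :=
  (isSmooth_strainFlat hv).continuous

/-- The flattened strain has zero mean (its entries are averages of derivatives). [ours] -/
theorem hasZeroMean_strainFlat {v : UnitAddTorus d → EuclideanSpace ℝ d} (hv : Torus.IsSmooth v) :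
    Torus.HasZeroMean (strainFlat v) := by
  show ∫ x, strainFlat v x = 0
  ext p
  rw [EuclideanCoord.integral_apply_coord (continuous_strainFlat hv)]
  simp only [strainFlat_apply]
  have h1 : ∀ i j : d, ∫ x, Torus.partialDeriv j v x i = 0 := by
    intro i j
    have e : ∀ x, Torus.partialDeriv j v x i = Torus.partialDeriv j (fun y => v y i) x :=
      fun x => (Torus.partialDeriv_apply_coord (hv.isContDiff (by simp)) j x i).symm
    simp_rw [e]
    exact integral_partialDeriv_eq_zero_holds (hv.apply i) j
  have hi1 : Integrable (fun x => Torus.partialDeriv p.2 v x p.1) :=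
    ((hv.partialDeriv p.2).apply p.1).continuous.integrable_unitAddTorus
  have hi2 : Integrable (fun x => Torus.partialDeriv p.1 v x p.2) :=
    ((hv.partialDeriv p.1).apply p.2).continuous.integrable_unitAddTorus
  rw [integral_div, integral_add hi1 hi2, h1, h1]
  simp

/-- `∑ₖ ‖∂ₖ strainFlat v‖² = ∑ₖ∑ᵢⱼ (∂ₖSᵢⱼ)²` with `∂ₖSᵢⱼ = (∂ₖ(∂ⱼv)ᵢ + ∂ₖ(∂ᵢv)ⱼ)/2`. [ours] -/
theorem sum_norm_partialDeriv_strainFlat_sq {v : UnitAddTorus d → EuclideanSpace ℝ d}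
    (hv : Torus.IsSmooth v) (x : UnitAddTorus d) :
    ∑ k, ‖Torus.partialDeriv k (strainFlat v) x‖ ^ 2 =
      ∑ k, ∑ i, ∑ j, ((Torus.partialDeriv k (Torus.partialDeriv j v) x i +
        Torus.partialDeriv k (Torus.partialDeriv i v) x j) / 2) ^ 2 := by
  refine Finset.sum_congr rfl fun k _ => ?_
  rw [EuclideanCoord.norm_sq_eq_sum_sq, Fintype.sum_prod_type]
  refine Finset.sum_congr rfl fun i _ => Finset.sum_congr rfl fun j _ => ?_
  have h := EuclideanCoord.partialDeriv_apply_coord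
    ((isSmooth_strainFlat hv).isContDiff (by simp)) k x (i, j)
  rw [← h]
  simp only [strainFlat_apply]
  rw [GradientTensor.partialDeriv_strainEntry hv i j k x]

/-- **Top node for the strain on `T³`**: there is `C ≥ 0` with
`∫ |S|¹² ≤ C (∫ |S|² ∑ₖ∑ᵢⱼ(∂ₖSᵢⱼ)²)³` for every smooth velocity field (`|S|¹² = (|S|²)⁶`; the
codomain-generic top node `CodomainNP.exists_integral_norm_rpow_top_le_three` at `a = 1` applied to
`strainFlat v`). [ours] -/
theorem exists_strainSq_pow_six_le_cube :
    ∃ C : ℝ, 0 ≤ C ∧ ∀ v : UnitAddTorus (Fin 3) → EuclideanSpace ℝ (Fin 3), Torus.IsSmooth v →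
      ∫ x, torusStrainSqAt v x ^ 6 ≤
        C * (∫ x, torusStrainSqAt v x * ∑ k, ∑ i, ∑ j,
          ((Torus.partialDeriv k (Torus.partialDeriv j v) x i +
            Torus.partialDeriv k (Torus.partialDeriv i v) x j) / 2) ^ 2) ^ 3 := by
  obtain ⟨C, hC0, hC⟩ := CodomainNP.exists_integral_norm_rpow_top_le_three
    (F := EuclideanSpace ℝ (Fin 3 × Fin 3)) (d := Fin 3) (by simp) one_pos
  refine ⟨C, hC0, fun v hv => ?_⟩
  have h := hC (strainFlat v) (isSmooth_strainFlat hv) (hasZeroMean_strainFlat hv)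
  have e1 : ∀ x, ‖strainFlat v x‖ ^ (6 * (1 : ℝ) + 6) = torusStrainSqAt v x ^ 6 := by
    intro x
    rw [show (6 : ℝ) * 1 + 6 = ((12 : ℕ) : ℝ) by norm_num, Real.rpow_natCast,
      show (12 : ℕ) = 2 * 6 by norm_num, pow_mul, norm_strainFlat_sq]
  have e2 : ∀ x, ‖strainFlat v x‖ ^ (2 * (1 : ℝ)) * ∑ k, ‖Torus.partialDeriv k (strainFlat v) x‖ ^ 2 =
      torusStrainSqAt v x * ∑ k, ∑ i, ∑ j,
        ((Torus.partialDeriv k (Torus.partialDeriv j v) x i +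
          Torus.partialDeriv k (Torus.partialDeriv i v) x j) / 2) ^ 2 := by
    intro x
    rw [show (2 : ℝ) * 1 = ((2 : ℕ) : ℝ) by norm_num, Real.rpow_natCast, norm_strainFlat_sq,
      sum_norm_partialDeriv_strainFlat_sq hv]
  simp_rw [e1, e2] at h
  exact h

end StrainL4

end Summit.NavierStokesRegularity.FunctionalMining
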